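import Summits.AnomalousDissipation.AnomalousDissipation.Theorems.TaylorCertificatesKolmogorovFloorResponseDefs

/-!
# Tools for the LINE-ALGEBRA stub of line `Sketch` (digit-frame-closure), crux stmt-AnomalousDissipation-15122

Elementary unfoldings of the closed-form response sequences of
`Theorems/TaylorCertificatesKolmogorovFloorResponseDefs.lean` (§3 there), all in the sub-namespace
`…KolmogorovFloor.Response.LineAlgebra`:

* support of `Λ, y, P, x, z` on the odd window `{m odd, |m| ≤ 2J+1}` (`Lam_eq_zero`, `yC_eq_zero`, `PC_eq_zero`,
  `xC_eq_zero`, `zC_eq_zero`);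
* the integer bookkeeping `E_{m∓1} = N_m ∓ 2T_m`, `T_{m±1} = T_m ± X2`, `N_0 = K`, `T_0 = s`,
  `T_m²/X2 = s²/X2 + N_m − K`;
* transversality `a x_m + T_m y_m + c z_m = 0` and the `w = c e − a n` component `c e2 x_m − a n2 z_m = P_m`
  (`D ≠ 0`);
* `E_m y_m = Λ_m`, the closed form of the `ξ`-residual `Rx_m = (πa/N_m)(Λ_{m−1} − Λ_{m+1}) − [m=0] vx` and its
  vanishing off the two edge sites `m = ±(2J+2)` (`RxC_eq_zero`);
* the two frame combinations of the `e`- and `n`-residuals: `a·Re_m + T_m·Rx_m + c·Rn_m = 0` (`combo_k`, uses the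
  solenoidality of the force and Parseval in the triad) and `c e2·Re_m − a n2·Rn_m = −πa (P_{m+1} − P_{m−1} − inc_m)`
  (`combo_w`).

Pure algebra over `ℂ` (`field_simp`, `ring`, `linear_combination`, `omega`); no analysis.
-/

noncomputable section

set_option linter.dupNamespace false -- the problem path repeats `AnomalousDissipation` (forced namespace)

open Finset
open scoped BigOperators ComplexConjugate

namespace Summit.AnomalousDissipation.AnomalousDissipation.Theorems.KolmogorovFloor.Response.LineAlgebra

variable (d : LineData) (F : LineForce) (J : ℕ)

/-! ## Support on the odd window -/

/-- `Λ_m = 0` off the odd window. -/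
theorem Lam_eq_zero {m : ℤ} (h : m % 2 = 0 ∨ 2 * (J : ℤ) + 1 < |m|) : Lam d F J m = 0 := by
  unfold Lam; exact if_pos h

/-- `y_m = 0` off the odd window. -/
theorem yC_eq_zero {m : ℤ} (h : m % 2 = 0 ∨ 2 * (J : ℤ) + 1 < |m|) : yC d F J m = 0 := by
  unfold yC; rw [Lam_eq_zero d F J h, zero_div]

/-- `P_m = 0` off the odd window (at even `m` by definition; beyond the window the defining filter is empty). -/
theorem PC_eq_zero {m : ℤ} (h : m % 2 = 0 ∨ 2 * (J : ℤ) + 1 < |m|) : PC d F J m = 0 := by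
  unfold PC
  by_cases h0 : m % 2 = 0
  · exact if_pos h0
  have h' : 2 * (J : ℤ) + 1 < |m| := h.resolve_left h0
  rw [if_neg h0]
  simp only [Int.abs_eq_natAbs] at h'
  split_ifs with hm
  · rw [Finset.filter_false_of_mem, Finset.sum_empty, neg_zero]
    intro i hi
    rw [Finset.mem_range] at hi
    omega
  · rw [Finset.filter_false_of_mem, Finset.sum_empty]
    intro i hi
    rw [Finset.mem_range] at hi
    omega

/-- `x_m = 0` off the odd window. -/
theorem xC_eq_zero {m : ℤ} (h : m % 2 = 0 ∨ 2 * (J : ℤ) + 1 < |m|) : xC d F J m = 0 := by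
  unfold xC; rw [PC_eq_zero d F J h, yC_eq_zero d F J h]; simp

/-- `z_m = 0` off the odd window. -/
theorem zC_eq_zero {m : ℤ} (h : m % 2 = 0 ∨ 2 * (J : ℤ) + 1 < |m|) : zC d F J m = 0 := by
  unfold zC; rw [PC_eq_zero d F J h, yC_eq_zero d F J h]; simp

/-! ## Integer bookkeeping -/

/-- `D = c² e2 + a² n2` in `ℂ`. -/
theorem D_cast : (d.D : ℂ) = (d.c : ℂ) ^ 2 * (d.e2 : ℂ) + (d.a : ℂ) ^ 2 * (d.n2 : ℂ) := by
  simp only [LineData.D]; push_cast; ring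

/-- `E_{m−1} = N_m − 2T_m`. -/
theorem E_pred (m : ℤ) : d.E (m - 1) = d.N m - 2 * d.T m := by
  simp only [LineData.E, LineData.N, LineData.T]; ring

/-- `E_{m+1} = N_m + 2T_m`. -/
theorem E_succ (m : ℤ) : d.E (m + 1) = d.N m + 2 * d.T m := by
  simp only [LineData.E, LineData.N, LineData.T]; ring

/-- `T_{m−1} = T_m − X2`. -/
theorem T_pred (m : ℤ) : d.T (m - 1) = d.T m - d.X2 := by
  simp only [LineData.T]; ring

/-- `T_{m+1} = T_m + X2`. -/
theorem T_succ (m : ℤ) : d.T (m + 1) = d.T m + d.X2 := by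
  simp only [LineData.T]; ring

/-- `N_0 = K`. -/
theorem N_zero : d.N 0 = d.K := by
  simp [LineData.N]

/-- `T_0 = s`. -/
theorem T_zero : d.T 0 = d.s := by
  simp [LineData.T]

/-- `T_m² / X2 = s²/X2 + N_m − K` (for `X2 ≠ 0`). -/
theorem T_sq_div (hX : d.X2 ≠ 0) (m : ℤ) :
    (d.T m : ℂ) ^ 2 / (d.X2 : ℂ) = (d.s : ℂ) ^ 2 / (d.X2 : ℂ) + (d.N m : ℂ) - (d.K : ℂ) := by
  have hX' : (d.X2 : ℂ) ≠ 0 := by exact_mod_cast hX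
  simp only [LineData.T, LineData.N]
  push_cast
  field_simp
  ring

/-! ## Transversality and the `w`-component -/

/-- **Transversality** `a x_m + T_m y_m + c z_m = 0` (`D ≠ 0`). -/
theorem transversal (hD : d.D ≠ 0) (m : ℤ) :
    (d.a : ℂ) * xC d F J m + (d.T m : ℂ) * yC d F J m + (d.c : ℂ) * zC d F J m = 0 := by
  have hD' : (d.D : ℂ) ≠ 0 := by exact_mod_cast hD
  rw [D_cast] at hD'
  unfold xC zC
  rw [D_cast]
  field_simp
  ring

/-- `c e2 x_m − a n2 z_m = P_m` (`D ≠ 0`). -/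
theorem w_component (hD : d.D ≠ 0) (m : ℤ) :
    (d.c : ℂ) * (d.e2 : ℂ) * xC d F J m - (d.a : ℂ) * (d.n2 : ℂ) * zC d F J m = PC d F J m := by
  have hD' : (d.D : ℂ) ≠ 0 := by exact_mod_cast hD
  rw [D_cast] at hD'
  unfold xC zC
  rw [D_cast]
  field_simp
  ring

/-! ## `E y = Λ` and the `ξ`-residual -/

/-- `E_m y_m = Λ_m` (given `E_m ≠ 0` at odd `m`; at even `m` both sides vanish). -/
theorem E_mul_yC (hE : ∀ m : ℤ, m % 2 = 1 → d.E m ≠ 0) (m : ℤ) :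
    (d.E m : ℂ) * yC d F J m = Lam d F J m := by
  unfold yC
  by_cases h : m % 2 = 0
  · rw [Lam_eq_zero d F J (Or.inl h)]; simp
  · have h' : (d.E m : ℂ) ≠ 0 := by exact_mod_cast hE m (by omega)
    field_simp

/-- Closed form of the `ξ`-residual: `Rx_m = (πa/N_m)(Λ_{m−1} − Λ_{m+1}) − [m=0] vx`. -/
theorem RxC_eq (hX : d.X2 ≠ 0) (hE : ∀ m : ℤ, m % 2 = 1 → d.E m ≠ 0) (hN : ∀ m : ℤ, d.N m ≠ 0) (m : ℤ) :
    RxC d F J m = (Real.pi : ℂ) * (d.a : ℂ) / (d.N m : ℂ) * (Lam d F J (m - 1) - Lam d F J (m + 1))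
      - (if m = 0 then F.vx else 0) := by
  rw [← E_mul_yC d F J hE (m - 1), ← E_mul_yC d F J hE (m + 1), E_pred, E_succ]
  have hN' : (d.N m : ℂ) ≠ 0 := by exact_mod_cast hN m
  have hX' : (d.X2 : ℂ) ≠ 0 := by exact_mod_cast hX
  unfold RxC qC
  push_cast
  field_simp
  ring

/-- `Λ_1 = λ₊`. -/
theorem Lam_one : Lam d F J 1 = lamP d F J := by
  unfold Lam
  rw [if_neg (by simp only [Int.abs_eq_natAbs]; omega), if_pos one_pos]

/-- `Λ_{−1} = λ₋`. -/
theorem Lam_neg_one : Lam d F J (-1) = lamM d F J := by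
  unfold Lam
  rw [if_neg (by simp only [Int.abs_eq_natAbs]; omega), if_neg (by norm_num)]

/-- The jump `λ₋ − λ₊ = σ` (`G ≠ 0`). -/
theorem lamM_sub_lamP (hG : d.G J ≠ 0) : lamM d F J - lamP d F J = sigmaC d F := by
  have hG' : ((d.G J : ℝ) : ℂ) ≠ 0 := Complex.ofReal_ne_zero.mpr hG
  unfold lamM lamP
  rw [← sub_div, div_eq_iff hG']
  simp only [LineData.G, Complex.ofReal_add]
  ring

/-- At an even `m ≠ 0` off the edge sites, `Λ_{m−1} = Λ_{m+1}` (both `λ₊`, both `λ₋`, or both `0`). -/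
theorem Lam_pred_eq_Lam_succ {m : ℤ} (h2 : m % 2 = 0) (h0 : m ≠ 0) (hm : |m| ≠ 2 * (J : ℤ) + 2) :
    Lam d F J (m - 1) = Lam d F J (m + 1) := by
  unfold Lam
  simp only [Int.abs_eq_natAbs] at hm
  by_cases hw : m.natAbs ≤ 2 * J
  · have h1 : ¬((m - 1) % 2 = 0 ∨ 2 * (J : ℤ) + 1 < |m - 1|) := by
      simp only [Int.abs_eq_natAbs]; omega
    have h3 : ¬((m + 1) % 2 = 0 ∨ 2 * (J : ℤ) + 1 < |m + 1|) := by
      simp only [Int.abs_eq_natAbs]; omega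
    rw [if_neg h1, if_neg h3]
    by_cases hp : 0 < m
    · rw [if_pos (show 0 < m - 1 by omega), if_pos (show 0 < m + 1 by omega)]
    · rw [if_neg (show ¬(0 < m - 1) by omega), if_neg (show ¬(0 < m + 1) by omega)]
  · have h1 : (m - 1) % 2 = 0 ∨ 2 * (J : ℤ) + 1 < |m - 1| := by
      simp only [Int.abs_eq_natAbs]; omega
    have h3 : (m + 1) % 2 = 0 ∨ 2 * (J : ℤ) + 1 < |m + 1| := by
      simp only [Int.abs_eq_natAbs]; omega
    rw [if_pos h1, if_pos h3]

/-- **The `ξ`-residual vanishes off the edge sites** `m = ±(2J+2)`. -/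
theorem RxC_eq_zero (ha : d.a ≠ 0) (hX : d.X2 ≠ 0) (hG : d.G J ≠ 0) (hE : ∀ m : ℤ, m % 2 = 1 → d.E m ≠ 0)
    (hN : ∀ m : ℤ, d.N m ≠ 0) {m : ℤ} (hm : |m| ≠ 2 * (J : ℤ) + 2) : RxC d F J m = 0 := by
  rw [RxC_eq d F J hX hE hN m]
  rcases eq_or_ne m 0 with rfl | h0
  · rw [if_pos rfl, zero_sub, zero_add, Lam_neg_one, Lam_one, lamM_sub_lamP d F J hG, N_zero]
    unfold sigmaC
    have hK : (d.K : ℂ) ≠ 0 := by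
      have h := hN 0
      rw [N_zero] at h
      exact_mod_cast h
    have ha' : (d.a : ℂ) ≠ 0 := by exact_mod_cast ha
    have hpi : (Real.pi : ℂ) ≠ 0 := by exact_mod_cast Real.pi_ne_zero
    field_simp
    ring
  · rw [if_neg h0, sub_zero]
    by_cases h2 : m % 2 = 0
    · rw [Lam_pred_eq_Lam_succ d F J h2 h0 hm, sub_self, mul_zero]
    · rw [Lam_eq_zero d F J (Or.inl (by omega : (m - 1) % 2 = 0)),
        Lam_eq_zero d F J (Or.inl (by omega : (m + 1) % 2 = 0)), sub_self, mul_zero]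

/-! ## The two frame combinations of the `e`- and `n`-residuals -/

/-- `a·Re_m + T_m·Rx_m + c·Rn_m = 0`: the `k + mξ` component of the residual is pure pressure. -/
theorem combo_k (hX : d.X2 ≠ 0) (hD : d.D ≠ 0) (hN : ∀ m : ℤ, d.N m ≠ 0)
    (hdiv : (d.a : ℂ) * F.ve + (d.s : ℂ) * F.vx + (d.c : ℂ) * F.vn = 0)
    (hP : (d.a : ℂ) ^ 2 / (d.e2 : ℂ) + (d.s : ℂ) ^ 2 / (d.X2 : ℂ) + (d.c : ℂ) ^ 2 / (d.n2 : ℂ) = (d.K : ℂ))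
    (m : ℤ) :
    (d.a : ℂ) * ReC d F J m + (d.T m : ℂ) * RxC d F J m + (d.c : ℂ) * RnC d F J m = 0 := by
  have t1 := transversal d F J hD (m - 1)
  have t2 := transversal d F J hD (m + 1)
  rw [T_pred] at t1
  rw [T_succ] at t2
  push_cast at t1 t2
  have hN' : (d.N m : ℂ) ≠ 0 := by exact_mod_cast hN m
  have hq : qC d F J m * (d.N m : ℂ)
      = 2 * (Real.pi : ℂ) * (d.a : ℂ) * (d.X2 : ℂ) * (yC d F J (m - 1) + yC d F J (m + 1)) := by
    unfold qC
    field_simp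
  have hsum : (d.a : ℂ) ^ 2 / (d.e2 : ℂ) + (d.T m : ℂ) ^ 2 / (d.X2 : ℂ) + (d.c : ℂ) ^ 2 / (d.n2 : ℂ)
      = (d.N m : ℂ) := by
    rw [T_sq_div d hX m]
    linear_combination hP
  have hforce : (d.a : ℂ) * (if m = 0 then F.ve else 0) + (d.T m : ℂ) * (if m = 0 then F.vx else 0)
      + (d.c : ℂ) * (if m = 0 then F.vn else 0) = 0 := by
    split_ifs with h
    · subst h
      rw [T_zero]
      exact hdiv
    · simp
  unfold ReC RxC RnC
  linear_combination ((Real.pi : ℂ) * (d.a : ℂ)) * t1 - ((Real.pi : ℂ) * (d.a : ℂ)) * t2 - hq - hforce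
    - qC d F J m * hsum

/-- `c e2 ve − a n2 vn = πa ρ`. -/
theorem force_w (ha : d.a ≠ 0) :
    (d.c : ℂ) * (d.e2 : ℂ) * F.ve - (d.a : ℂ) * (d.n2 : ℂ) * F.vn = (Real.pi : ℂ) * (d.a : ℂ) * rhoC d F := by
  have ha' : (d.a : ℂ) ≠ 0 := by exact_mod_cast ha
  have hpi : (Real.pi : ℂ) ≠ 0 := by exact_mod_cast Real.pi_ne_zero
  unfold rhoC
  field_simp

/-- `c e2·Re_m − a n2·Rn_m = −πa (P_{m+1} − P_{m−1} − inc_m)`: the `w = c e − a n` component of the residual. -/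
theorem combo_w (ha : d.a ≠ 0) (he : d.e2 ≠ 0) (hn : d.n2 ≠ 0) (hD : d.D ≠ 0) (m : ℤ) :
    (d.c : ℂ) * (d.e2 : ℂ) * ReC d F J m - (d.a : ℂ) * (d.n2 : ℂ) * RnC d F J m
      = -((Real.pi : ℂ) * (d.a : ℂ)) * (PC d F J (m + 1) - PC d F J (m - 1) - incC d F J m) := by
  have w1 := w_component d F J hD (m - 1)
  have w2 := w_component d F J hD (m + 1)
  have he' : (d.e2 : ℂ) ≠ 0 := by exact_mod_cast he
  have hn' : (d.n2 : ℂ) ≠ 0 := by exact_mod_cast hn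
  have hq1 : (d.c : ℂ) * (d.e2 : ℂ) * (qC d F J m * (d.a : ℂ) / (d.e2 : ℂ))
      = (d.c : ℂ) * (d.a : ℂ) * qC d F J m := by
    field_simp
  have hq2 : (d.a : ℂ) * (d.n2 : ℂ) * (qC d F J m * (d.c : ℂ) / (d.n2 : ℂ))
      = (d.c : ℂ) * (d.a : ℂ) * qC d F J m := by
    field_simp
  have hforce : (d.c : ℂ) * (d.e2 : ℂ) * (if m = 0 then F.ve else 0)
      - (d.a : ℂ) * (d.n2 : ℂ) * (if m = 0 then F.vn else 0)
      = (Real.pi : ℂ) * (d.a : ℂ) * (if m = 0 then rhoC d F else 0) := by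
    split_ifs with h
    · exact force_w d F ha
    · simp
  have ha' : (d.a : ℂ) ≠ 0 := by exact_mod_cast ha
  have hk : (Real.pi : ℂ) * (d.a : ℂ) * ((d.X2 : ℂ) * (d.c : ℂ) * (d.e2 : ℂ) / (d.a : ℂ))
      = (Real.pi : ℂ) * (d.X2 : ℂ) * (d.c : ℂ) * (d.e2 : ℂ) := by
    field_simp
  unfold ReC RnC incC
  linear_combination ((Real.pi : ℂ) * (d.a : ℂ)) * w1 - ((Real.pi : ℂ) * (d.a : ℂ)) * w2 - hq1 + hq2 - hforce
    - (yC d F J (m - 1) + yC d F J (m + 1)) * hk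

end Summit.AnomalousDissipation.AnomalousDissipation.Theorems.KolmogorovFloor.Response.LineAlgebra
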